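import Summits.CriticalPhenomena.PercolationContinuityZ3.Theorems.Transplant.FKConnectivityAllQPat3KNetSPSteps
import Summits.CriticalPhenomena.PercolationContinuityZ3.Theorems.Transplant.FKConnectivityAllQPat3KNetViewsPar
import Summits.CriticalPhenomena.PercolationContinuityZ3.Theorems.Transplant.FKConnectivityAllQPat3MinorRecursion
import HarnessLib

/-!
# Connectivity correlation inequalities for `φ_{w,q}`, every `q > 0` — THEOREM SP(𝒦), type I, the BRIDGE side: the recursive sub-cases

Helper file (`--supports stmt-CriticalPhenomena-4575`), census lineage (gen 41) of LANE 2's FK sub-programme; builds on p205010 (kernel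
theorem, internal audit signed; external expert review pending).  No definitions, no named facts, no sorries; standard axioms.

The type-I step of THEOREM SP(𝒦)'s inner recursion (census g41 memo §6 (c), drafts/README): `N = E₁ ∥ E₂` between `x, y`, marks
`s, t` inner in `E₁`, `b` inner in `E₂`, and `E₁ = BRIDGE(Qac, Qad, Qbc, Qbd, Qcd; x, y)`.  This file discharges the sub-cases that are
ONE VIEW away from the induction hypothesis or from a packaged leaf («Pat3KNetViewsPar» + «Pat3KNetSPSteps»); the induction hypothesis is
the explicit hypothesis `ih` (the type-I statement for sides of size `≤ n`):
* `FK.typeIK_bridge_slot_cd / _slot_ac` — both marks interior to the slot `cd` / `ac` ⇒ `ih` at the view;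
* `FK.typeIK_bridge_corner_cd / _corner_ac` — one mark the corner `c`, the other interior to `Qcd` / `Qac` ⇒ CORNER leaf at the view;
* `FK.typeIK_bridge_corners` — the marks are the two corners `c, d` ⇒ THEOREM 𝒯₂(𝒦) at the view `cd`.
The other slots follow by `FK.BridgeSep.swap_cd / symm`; the sub-cases with the marks in two different slots (EEE leaves) or a corner plus a
slot avoiding it (VEE* leaves) are the K-state leaf files' business (successor).
[cite: AyyerLinussonRavichandran2025, §7 (p. 22)]
-/

namespace Summit.CriticalPhenomena.PercolationContinuityZ3.Theorems

namespace FK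

open SimpleGraph Literature.Probability.LatticeModels Literature.Probability.Percolation
open scoped Classical

variable {V : Type*}

section TypeIBridge

variable [Fintype V] {n : ℕ} {N₀ : Finset (Sym2 V)} {Qac Qad Qbc Qbd Qcd E₂ E C : Finset (Sym2 V)} {x y c d b s t : V}

omit [Fintype V] in
/-- A vertex of the parallel part `E₂` other than the poles is off the bridge `E₁`. [folklore] -/
theorem off_bridge_of_mem_par {E₁ : Finset (Sym2 V)} (hV : ∀ z : V, (∃ e ∈ E₁, z ∈ e) → (∃ e ∈ E₂, z ∈ e) → z = x ∨ z = y)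
    (hb : ∃ e ∈ E₂, b ∈ e) (hbx : b ≠ x) (hby : b ≠ y) {Q : Finset (Sym2 V)} (hQ : Q ⊆ E₁) : ¬ ∃ e ∈ Q, b ∈ e :=
  fun ⟨e, he, hbe⟩ => (hV b ⟨e, hQ he, hbe⟩ hb).elim hbx hby

omit [Fintype V] in
/-- **Type I, bridge side, both marks interior to the slot `cd`**: the view at `cd` is a parallel composition with the strictly smaller
side `Qcd` carrying `s, t` and the completed bridge carrying `b` — the induction hypothesis applies. [cite: AyyerLinussonRavichandran2025, §7 (p. 22)] -/
theorem typeIK_bridge_slot_cd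
    (ih : ∀ {E₁ E₂ E C : Finset (Sym2 V)} {x y b s t : V}, E₁.card ≤ n →
      IsKNet E₁ x y → IsKNet E₂ x y → Disjoint E₁ E₂ → E₁ ∪ E₂ ⊆ N₀ →
      (∀ z : V, (∃ e ∈ E₁, z ∈ e) → (∃ e ∈ E₂, z ∈ e) → z = x ∨ z = y) →
      E ⊆ E₁ ∪ E₂ → C ⊆ E₁ ∪ E₂ →
      (∃ e ∈ E₁, s ∈ e) → (∃ e ∈ E₁, t ∈ e) → (∃ e ∈ E₂, b ∈ e) →
      s ≠ x → s ≠ y → t ≠ x → t ≠ y → b ≠ x → b ≠ y → s ≠ t → SPGoodC E C b s t)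
    (hac : IsKNet Qac x c) (had : IsKNet Qad x d) (hbc : IsKNet Qbc y c) (hbd : IsKNet Qbd y d) (hcd : IsKNet Qcd c d)
    (hsep : BridgeSep Qac Qad Qbc Qbd Qcd x y c d) (hcard : (Qac ∪ Qad ∪ Qbc ∪ Qbd ∪ Qcd).card ≤ n + 1) (h₂ : IsKNet E₂ x y)
    (hd : Disjoint (Qac ∪ Qad ∪ Qbc ∪ Qbd ∪ Qcd) E₂) (hN : Qac ∪ Qad ∪ Qbc ∪ Qbd ∪ Qcd ∪ E₂ ⊆ N₀)
    (hV : ∀ z : V, (∃ e ∈ Qac ∪ Qad ∪ Qbc ∪ Qbd ∪ Qcd, z ∈ e) → (∃ e ∈ E₂, z ∈ e) → z = x ∨ z = y)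
    (hE : E ⊆ Qac ∪ Qad ∪ Qbc ∪ Qbd ∪ Qcd ∪ E₂) (hC : C ⊆ Qac ∪ Qad ∪ Qbc ∪ Qbd ∪ Qcd ∪ E₂)
    (hs : ∃ e ∈ Qcd, s ∈ e) (ht : ∃ e ∈ Qcd, t ∈ e) (hb : ∃ e ∈ E₂, b ∈ e)
    (hsc : s ≠ c) (hsd : s ≠ d) (htc : t ≠ c) (htd : t ≠ d) (hbx : b ≠ x) (hby : b ≠ y) (hst : s ≠ t) : SPGoodC E C b s t := by
  obtain ⟨eN, hB, hdQ, hVQ⟩ := bridgePar_view_cd hac had hbc hbd hsep h₂ hd hV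
  have hlt := card_cd_lt_bridge hac hsep
  rw [eN] at hE hC hN
  have hbE₁ := off_bridge_of_mem_par hV hb hbx hby subset_rfl
  have hbc' : b ≠ c := fun h => hbE₁ ⟨_, (Finset.mem_union_left _ (Finset.mem_union_left _ (Finset.mem_union_left _
    (Finset.mem_union_left _ (Classical.choose_spec hac.right_mem).1)))), h ▸ (Classical.choose_spec hac.right_mem).2⟩
  have hbd' : b ≠ d := fun h => hbE₁ ⟨_, (Finset.mem_union_left _ (Finset.mem_union_left _ (Finset.mem_union_left _
    (Finset.mem_union_right _ (Classical.choose_spec had.right_mem).1)))), h ▸ (Classical.choose_spec had.right_mem).2⟩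
  obtain ⟨f, hf, hbf⟩ := hb
  exact ih (by omega) hcd hB hdQ hN hVQ hE hC hs ht ⟨f, Finset.mem_union_right _ hf, hbf⟩ hsc hsd htc htd hbc' hbd' hst

omit [Fintype V] in
/-- **Type I, bridge side, both marks interior to the slot `ac`**: the view at `ac`. [cite: AyyerLinussonRavichandran2025, §7 (p. 22)] -/
theorem typeIK_bridge_slot_ac
    (ih : ∀ {E₁ E₂ E C : Finset (Sym2 V)} {x y b s t : V}, E₁.card ≤ n →
      IsKNet E₁ x y → IsKNet E₂ x y → Disjoint E₁ E₂ → E₁ ∪ E₂ ⊆ N₀ →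
      (∀ z : V, (∃ e ∈ E₁, z ∈ e) → (∃ e ∈ E₂, z ∈ e) → z = x ∨ z = y) →
      E ⊆ E₁ ∪ E₂ → C ⊆ E₁ ∪ E₂ →
      (∃ e ∈ E₁, s ∈ e) → (∃ e ∈ E₁, t ∈ e) → (∃ e ∈ E₂, b ∈ e) →
      s ≠ x → s ≠ y → t ≠ x → t ≠ y → b ≠ x → b ≠ y → s ≠ t → SPGoodC E C b s t)
    (hac : IsKNet Qac x c) (had : IsKNet Qad x d) (hbc : IsKNet Qbc y c) (hbd : IsKNet Qbd y d) (hcd : IsKNet Qcd c d)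
    (hsep : BridgeSep Qac Qad Qbc Qbd Qcd x y c d) (hcard : (Qac ∪ Qad ∪ Qbc ∪ Qbd ∪ Qcd).card ≤ n + 1) (h₂ : IsKNet E₂ x y)
    (hd : Disjoint (Qac ∪ Qad ∪ Qbc ∪ Qbd ∪ Qcd) E₂) (hN : Qac ∪ Qad ∪ Qbc ∪ Qbd ∪ Qcd ∪ E₂ ⊆ N₀)
    (hV : ∀ z : V, (∃ e ∈ Qac ∪ Qad ∪ Qbc ∪ Qbd ∪ Qcd, z ∈ e) → (∃ e ∈ E₂, z ∈ e) → z = x ∨ z = y)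
    (hE : E ⊆ Qac ∪ Qad ∪ Qbc ∪ Qbd ∪ Qcd ∪ E₂) (hC : C ⊆ Qac ∪ Qad ∪ Qbc ∪ Qbd ∪ Qcd ∪ E₂)
    (hs : ∃ e ∈ Qac, s ∈ e) (ht : ∃ e ∈ Qac, t ∈ e) (hb : ∃ e ∈ E₂, b ∈ e)
    (hsx : s ≠ x) (hsc : s ≠ c) (htx : t ≠ x) (htc : t ≠ c) (hbx : b ≠ x) (hby : b ≠ y) (hst : s ≠ t) : SPGoodC E C b s t := by
  obtain ⟨eN, hB, hdQ, hVQ⟩ := bridgePar_view_ac hac had hbc hbd hcd hsep h₂ hd hV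
  have hlt := card_ac_lt_bridge hcd hsep
  rw [eN] at hE hC hN
  have hbE₁ := off_bridge_of_mem_par hV hb hbx hby subset_rfl
  have hbc' : b ≠ c := fun h => hbE₁ ⟨_, (Finset.mem_union_left _ (Finset.mem_union_left _ (Finset.mem_union_left _
    (Finset.mem_union_left _ (Classical.choose_spec hac.right_mem).1)))), h ▸ (Classical.choose_spec hac.right_mem).2⟩
  obtain ⟨f, hf, hbf⟩ := hb
  exact ih (by omega) hac hB hdQ hN hVQ hE hC hs ht ⟨f, Finset.mem_union_left _ (Finset.mem_union_left _ (Finset.mem_union_left _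
    (Finset.mem_union_left _ hf))), hbf⟩ hsx hsc htx htc hbx hbc' hst

/-- **Type I, bridge side, one mark the corner `c`, the other interior to `Qcd`**: at the view `cd` this is a CORNER (pieces `Qcd ∋ t` and
the completed bridge `∋ b`, corner `c`). [cite: AyyerLinussonRavichandran2025, §7 (p. 22)] -/
theorem typeIK_bridge_corner_cd
    (hac : IsKNet Qac x c) (had : IsKNet Qad x d) (hbc : IsKNet Qbc y c) (hbd : IsKNet Qbd y d) (hcd : IsKNet Qcd c d)
    (hsep : BridgeSep Qac Qad Qbc Qbd Qcd x y c d) (h₂ : IsKNet E₂ x y) (hd : Disjoint (Qac ∪ Qad ∪ Qbc ∪ Qbd ∪ Qcd) E₂)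
    (hV : ∀ z : V, (∃ e ∈ Qac ∪ Qad ∪ Qbc ∪ Qbd ∪ Qcd, z ∈ e) → (∃ e ∈ E₂, z ∈ e) → z = x ∨ z = y)
    (hE : E ⊆ Qac ∪ Qad ∪ Qbc ∪ Qbd ∪ Qcd ∪ E₂) (hC : C ⊆ Qac ∪ Qad ∪ Qbc ∪ Qbd ∪ Qcd ∪ E₂)
    (ht : ∃ e ∈ Qcd, t ∈ e) (hb : ∃ e ∈ E₂, b ∈ e) (htc : t ≠ c) (htd : t ≠ d) (hbx : b ≠ x) (hby : b ≠ y) :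
    SPGoodC E C b c t := by
  obtain ⟨eN, hB, hdQ, hVQ⟩ := bridgePar_view_cd hac had hbc hbd hsep h₂ hd hV
  rw [eN] at hE hC
  have hbE₁ := off_bridge_of_mem_par hV hb hbx hby subset_rfl
  have hbc' : b ≠ c := fun h => hbE₁ ⟨_, (Finset.mem_union_left _ (Finset.mem_union_left _ (Finset.mem_union_left _
    (Finset.mem_union_left _ (Classical.choose_spec hac.right_mem).1)))), h ▸ (Classical.choose_spec hac.right_mem).2⟩
  have hbd' : b ≠ d := fun h => hbE₁ ⟨_, (Finset.mem_union_left _ (Finset.mem_union_left _ (Finset.mem_union_left _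
    (Finset.mem_union_right _ (Classical.choose_spec had.right_mem).1)))), h ▸ (Classical.choose_spec had.right_mem).2⟩
  obtain ⟨f, hf, hbf⟩ := hb
  have hc := spGoodC_cornerK hdQ hVQ hcd hB (Finset.inter_subset_right (s₁ := E)) (Finset.inter_subset_right (s₁ := C))
    (Finset.inter_subset_right (s₁ := E)) (Finset.inter_subset_right (s₁ := C)) ht ⟨f, Finset.mem_union_right _ hf, hbf⟩ htc htd hbc' hbd'
  exact (hc.congr_sets (inter_union2_eq hE rfl) (inter_union2_eq hC rfl)).rotate'

/-- **Type I, bridge side, one mark the corner `c`, the other interior to `Qac`**: at the view `ac` (re-rooted at `c, x`) this is a CORNER.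
[cite: AyyerLinussonRavichandran2025, §7 (p. 22)] -/
theorem typeIK_bridge_corner_ac
    (hac : IsKNet Qac x c) (had : IsKNet Qad x d) (hbc : IsKNet Qbc y c) (hbd : IsKNet Qbd y d) (hcd : IsKNet Qcd c d)
    (hsep : BridgeSep Qac Qad Qbc Qbd Qcd x y c d) (h₂ : IsKNet E₂ x y) (hd : Disjoint (Qac ∪ Qad ∪ Qbc ∪ Qbd ∪ Qcd) E₂)
    (hV : ∀ z : V, (∃ e ∈ Qac ∪ Qad ∪ Qbc ∪ Qbd ∪ Qcd, z ∈ e) → (∃ e ∈ E₂, z ∈ e) → z = x ∨ z = y)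
    (hE : E ⊆ Qac ∪ Qad ∪ Qbc ∪ Qbd ∪ Qcd ∪ E₂) (hC : C ⊆ Qac ∪ Qad ∪ Qbc ∪ Qbd ∪ Qcd ∪ E₂)
    (ht : ∃ e ∈ Qac, t ∈ e) (hb : ∃ e ∈ E₂, b ∈ e) (htx : t ≠ x) (htc : t ≠ c) (hbx : b ≠ x) (hby : b ≠ y) :
    SPGoodC E C b c t := by
  obtain ⟨eN, hB, hdQ, hVQ⟩ := bridgePar_view_ac hac had hbc hbd hcd hsep h₂ hd hV
  rw [eN] at hE hC
  have hbE₁ := off_bridge_of_mem_par hV hb hbx hby subset_rfl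
  have hbc' : b ≠ c := fun h => hbE₁ ⟨_, (Finset.mem_union_left _ (Finset.mem_union_left _ (Finset.mem_union_left _
    (Finset.mem_union_left _ (Classical.choose_spec hac.right_mem).1)))), h ▸ (Classical.choose_spec hac.right_mem).2⟩
  obtain ⟨f, hf, hbf⟩ := hb
  have hVQ' : ∀ z : V, (∃ e ∈ Qac, z ∈ e) → (∃ e ∈ E₂ ∪ Qad ∪ Qbc ∪ Qcd ∪ Qbd, z ∈ e) → z = c ∨ z = x :=
    fun z h h' => (hVQ z h h').symm
  have hc := spGoodC_cornerK hdQ hVQ' hac.symm hB.symm (Finset.inter_subset_right (s₁ := E)) (Finset.inter_subset_right (s₁ := C))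
    (Finset.inter_subset_right (s₁ := E)) (Finset.inter_subset_right (s₁ := C)) ht
    ⟨f, Finset.mem_union_left _ (Finset.mem_union_left _ (Finset.mem_union_left _ (Finset.mem_union_left _ hf))), hbf⟩ htc htx hbc' hbx
  exact (hc.congr_sets (inter_union2_eq hE rfl) (inter_union2_eq hC rfl)).rotate'

/-- **Type I, bridge side, the marks are the corners `c, d`**: at the view `cd` the placement is (pole, pole, inner) — THEOREM 𝒯₂(𝒦)
(`FK.spGoodC_inner_of_isKNet`). [cite: AyyerLinussonRavichandran2025, §7 (p. 22)] -/
theorem typeIK_bridge_corners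
    (hac : IsKNet Qac x c) (had : IsKNet Qad x d) (hbc : IsKNet Qbc y c) (hbd : IsKNet Qbd y d) (hcd : IsKNet Qcd c d)
    (hsep : BridgeSep Qac Qad Qbc Qbd Qcd x y c d) (h₂ : IsKNet E₂ x y) (hd : Disjoint (Qac ∪ Qad ∪ Qbc ∪ Qbd ∪ Qcd) E₂)
    (hV : ∀ z : V, (∃ e ∈ Qac ∪ Qad ∪ Qbc ∪ Qbd ∪ Qcd, z ∈ e) → (∃ e ∈ E₂, z ∈ e) → z = x ∨ z = y)
    (hE : E ⊆ Qac ∪ Qad ∪ Qbc ∪ Qbd ∪ Qcd ∪ E₂) (hC : C ⊆ Qac ∪ Qad ∪ Qbc ∪ Qbd ∪ Qcd ∪ E₂)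
    (hb : ∃ e ∈ E₂, b ∈ e) (hbx : b ≠ x) (hby : b ≠ y) : SPGoodC E C b c d := by
  obtain ⟨eN, hB, hdQ, hVQ⟩ := bridgePar_view_cd hac had hbc hbd hsep h₂ hd hV
  rw [eN] at hE hC
  have hbE₁ := off_bridge_of_mem_par hV hb hbx hby subset_rfl
  have hbc' : b ≠ c := fun h => hbE₁ ⟨_, (Finset.mem_union_left _ (Finset.mem_union_left _ (Finset.mem_union_left _
    (Finset.mem_union_left _ (Classical.choose_spec hac.right_mem).1)))), h ▸ (Classical.choose_spec hac.right_mem).2⟩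
  have hbd' : b ≠ d := fun h => hbE₁ ⟨_, (Finset.mem_union_left _ (Finset.mem_union_left _ (Finset.mem_union_left _
    (Finset.mem_union_right _ (Classical.choose_spec had.right_mem).1)))), h ▸ (Classical.choose_spec had.right_mem).2⟩
  obtain ⟨f, hf, hbf⟩ := hb
  have hN : IsKNet (Qcd ∪ (Qac ∪ Qbc ∪ Qad ∪ Qbd ∪ E₂)) c d := IsKNet.parallel hcd hB hdQ hVQ
  exact (spGoodC_inner_of_isKNet hN hE hC ⟨f, Finset.mem_union_right _ (Finset.mem_union_right _ hf), hbf⟩ hbc' hbd').rotate'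

/-! ### The position dispatch of the type-I bridge branch (leaves as hypotheses)

The remaining sub-cases are K-state LEAVES; they enter as the hypotheses `hTri`, `hClaw`, `hPathMid`, `hPathEnd` (marks in two different
slots: with `E₂ ∋ b` the three marked slots form a triangle / claw / path with `E₂` in the middle / path with `E₂` at an end) and `hVee`
(a corner mark plus a marked slot avoiding it) — census g41 drafts/README; each is ONE K-state leaf instantiation («Pat3EeeLeafKTriClaw»,
«Pat3EeeLeafKPath», «Pat3VeeLeafK») after one-sided reduction of the mark-free slots, to be supplied by the successor. -/

/-- Type I, bridge side, the mark `s` IS the corner `c` (dispatch on `t`). [cite: AyyerLinussonRavichandran2025, §7 (p. 22)] -/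
theorem typeIK_bridge_at_c
    (hVee : ∀ {Qac Qad Qbc Qbd Qcd E₂ E C : Finset (Sym2 V)} {x y c d b t : V},
      IsKNet Qac x c → IsKNet Qad x d → IsKNet Qbc y c → IsKNet Qbd y d → IsKNet Qcd c d → BridgeSep Qac Qad Qbc Qbd Qcd x y c d →
      IsKNet E₂ x y → Disjoint (Qac ∪ Qad ∪ Qbc ∪ Qbd ∪ Qcd) E₂ → Qac ∪ Qad ∪ Qbc ∪ Qbd ∪ Qcd ∪ E₂ ⊆ N₀ →
      (∀ z : V, (∃ e ∈ Qac ∪ Qad ∪ Qbc ∪ Qbd ∪ Qcd, z ∈ e) → (∃ e ∈ E₂, z ∈ e) → z = x ∨ z = y) →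
      E ⊆ Qac ∪ Qad ∪ Qbc ∪ Qbd ∪ Qcd ∪ E₂ → C ⊆ Qac ∪ Qad ∪ Qbc ∪ Qbd ∪ Qcd ∪ E₂ →
      (∃ e ∈ Qad, t ∈ e) → t ≠ x → t ≠ d → (∃ e ∈ E₂, b ∈ e) → b ≠ x → b ≠ y → SPGoodC E C b c t)
    (hac : IsKNet Qac x c) (had : IsKNet Qad x d) (hbc : IsKNet Qbc y c) (hbd : IsKNet Qbd y d) (hcd : IsKNet Qcd c d)
    (hsep : BridgeSep Qac Qad Qbc Qbd Qcd x y c d) (h₂ : IsKNet E₂ x y)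
    (hd : Disjoint (Qac ∪ Qad ∪ Qbc ∪ Qbd ∪ Qcd) E₂) (hN : Qac ∪ Qad ∪ Qbc ∪ Qbd ∪ Qcd ∪ E₂ ⊆ N₀)
    (hV : ∀ z : V, (∃ e ∈ Qac ∪ Qad ∪ Qbc ∪ Qbd ∪ Qcd, z ∈ e) → (∃ e ∈ E₂, z ∈ e) → z = x ∨ z = y)
    (hE : E ⊆ Qac ∪ Qad ∪ Qbc ∪ Qbd ∪ Qcd ∪ E₂) (hC : C ⊆ Qac ∪ Qad ∪ Qbc ∪ Qbd ∪ Qcd ∪ E₂)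
    (hb : ∃ e ∈ E₂, b ∈ e) (hbx : b ≠ x) (hby : b ≠ y)
    (ht : ∃ e ∈ Qac ∪ Qad ∪ Qbc ∪ Qbd ∪ Qcd, t ∈ e) (htx : t ≠ x) (hty : t ≠ y) (htc : t ≠ c) : SPGoodC E C b c t := by
  by_cases htd : t = d
  · subst htd; exact typeIK_bridge_corners hac had hbc hbd hcd hsep h₂ hd hV hE hC hb hbx hby
  obtain ⟨e, he, hte⟩ := ht
  simp only [Finset.mem_union] at he
  rcases he with (((he | he) | he) | he) | he
  · exact typeIK_bridge_corner_ac hac had hbc hbd hcd hsep h₂ hd hV hE hC ⟨e, he, hte⟩ hb htx htc hbx hby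
  · exact hVee hac had hbc hbd hcd hsep h₂ hd hN hV hE hC ⟨e, he, hte⟩ htx htd hb hbx hby
  · have eN : Qac ∪ Qad ∪ Qbc ∪ Qbd ∪ Qcd = Qbc ∪ Qbd ∪ Qac ∪ Qad ∪ Qcd := by ac_rfl
    rw [eN] at hd hN hV hE hC
    exact typeIK_bridge_corner_ac hbc hbd hac had hcd hsep.symm h₂.symm hd (fun z h1 h2 => (hV z h1 h2).symm) hE hC ⟨e, he, hte⟩ hb
      hty htc hby hbx
  · have eN : Qac ∪ Qad ∪ Qbc ∪ Qbd ∪ Qcd = Qbc ∪ Qbd ∪ Qac ∪ Qad ∪ Qcd := by ac_rfl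
    rw [eN] at hd hN hV hE hC
    exact hVee hbc hbd hac had hcd hsep.symm h₂.symm hd hN (fun z h1 h2 => (hV z h1 h2).symm) hE hC ⟨e, he, hte⟩ hty htd hb hby hbx
  · exact typeIK_bridge_corner_cd hac had hbc hbd hcd hsep h₂ hd hV hE hC ⟨e, he, hte⟩ hb htc htd hbx hby

/-- Type I, bridge side, the mark `s` interior to the slot `ac` (dispatch on `t`). [cite: AyyerLinussonRavichandran2025, §7 (p. 22)] -/
theorem typeIK_bridge_in_ac
    (ih : ∀ {E₁ E₂ E C : Finset (Sym2 V)} {x y b s t : V}, E₁.card ≤ n →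
      IsKNet E₁ x y → IsKNet E₂ x y → Disjoint E₁ E₂ → E₁ ∪ E₂ ⊆ N₀ →
      (∀ z : V, (∃ e ∈ E₁, z ∈ e) → (∃ e ∈ E₂, z ∈ e) → z = x ∨ z = y) →
      E ⊆ E₁ ∪ E₂ → C ⊆ E₁ ∪ E₂ →
      (∃ e ∈ E₁, s ∈ e) → (∃ e ∈ E₁, t ∈ e) → (∃ e ∈ E₂, b ∈ e) →
      s ≠ x → s ≠ y → t ≠ x → t ≠ y → b ≠ x → b ≠ y → s ≠ t → SPGoodC E C b s t)
    (hTri : ∀ {Qac Qad Qbc Qbd Qcd E₂ E C : Finset (Sym2 V)} {x y c d b s t : V},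
      IsKNet Qac x c → IsKNet Qad x d → IsKNet Qbc y c → IsKNet Qbd y d → IsKNet Qcd c d → BridgeSep Qac Qad Qbc Qbd Qcd x y c d →
      IsKNet E₂ x y → Disjoint (Qac ∪ Qad ∪ Qbc ∪ Qbd ∪ Qcd) E₂ → Qac ∪ Qad ∪ Qbc ∪ Qbd ∪ Qcd ∪ E₂ ⊆ N₀ →
      (∀ z : V, (∃ e ∈ Qac ∪ Qad ∪ Qbc ∪ Qbd ∪ Qcd, z ∈ e) → (∃ e ∈ E₂, z ∈ e) → z = x ∨ z = y) →
      E ⊆ Qac ∪ Qad ∪ Qbc ∪ Qbd ∪ Qcd ∪ E₂ → C ⊆ Qac ∪ Qad ∪ Qbc ∪ Qbd ∪ Qcd ∪ E₂ →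
      (∃ e ∈ Qac, s ∈ e) → s ≠ x → s ≠ c →
      (∃ e ∈ Qbc, t ∈ e) → t ≠ y → t ≠ c → (∃ e ∈ E₂, b ∈ e) → b ≠ x → b ≠ y → SPGoodC E C b s t)
    (hClaw : ∀ {Qac Qad Qbc Qbd Qcd E₂ E C : Finset (Sym2 V)} {x y c d b s t : V},
      IsKNet Qac x c → IsKNet Qad x d → IsKNet Qbc y c → IsKNet Qbd y d → IsKNet Qcd c d → BridgeSep Qac Qad Qbc Qbd Qcd x y c d →
      IsKNet E₂ x y → Disjoint (Qac ∪ Qad ∪ Qbc ∪ Qbd ∪ Qcd) E₂ → Qac ∪ Qad ∪ Qbc ∪ Qbd ∪ Qcd ∪ E₂ ⊆ N₀ →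
      (∀ z : V, (∃ e ∈ Qac ∪ Qad ∪ Qbc ∪ Qbd ∪ Qcd, z ∈ e) → (∃ e ∈ E₂, z ∈ e) → z = x ∨ z = y) →
      E ⊆ Qac ∪ Qad ∪ Qbc ∪ Qbd ∪ Qcd ∪ E₂ → C ⊆ Qac ∪ Qad ∪ Qbc ∪ Qbd ∪ Qcd ∪ E₂ →
      (∃ e ∈ Qac, s ∈ e) → s ≠ x → s ≠ c →
      (∃ e ∈ Qad, t ∈ e) → t ≠ x → t ≠ d → (∃ e ∈ E₂, b ∈ e) → b ≠ x → b ≠ y → SPGoodC E C b s t)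
    (hPathMid : ∀ {Qac Qad Qbc Qbd Qcd E₂ E C : Finset (Sym2 V)} {x y c d b s t : V},
      IsKNet Qac x c → IsKNet Qad x d → IsKNet Qbc y c → IsKNet Qbd y d → IsKNet Qcd c d → BridgeSep Qac Qad Qbc Qbd Qcd x y c d →
      IsKNet E₂ x y → Disjoint (Qac ∪ Qad ∪ Qbc ∪ Qbd ∪ Qcd) E₂ → Qac ∪ Qad ∪ Qbc ∪ Qbd ∪ Qcd ∪ E₂ ⊆ N₀ →
      (∀ z : V, (∃ e ∈ Qac ∪ Qad ∪ Qbc ∪ Qbd ∪ Qcd, z ∈ e) → (∃ e ∈ E₂, z ∈ e) → z = x ∨ z = y) →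
      E ⊆ Qac ∪ Qad ∪ Qbc ∪ Qbd ∪ Qcd ∪ E₂ → C ⊆ Qac ∪ Qad ∪ Qbc ∪ Qbd ∪ Qcd ∪ E₂ →
      (∃ e ∈ Qac, s ∈ e) → s ≠ x → s ≠ c →
      (∃ e ∈ Qbd, t ∈ e) → t ≠ y → t ≠ d → (∃ e ∈ E₂, b ∈ e) → b ≠ x → b ≠ y → SPGoodC E C b s t)
    (hPathEnd : ∀ {Qac Qad Qbc Qbd Qcd E₂ E C : Finset (Sym2 V)} {x y c d b s t : V},
      IsKNet Qac x c → IsKNet Qad x d → IsKNet Qbc y c → IsKNet Qbd y d → IsKNet Qcd c d → BridgeSep Qac Qad Qbc Qbd Qcd x y c d →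
      IsKNet E₂ x y → Disjoint (Qac ∪ Qad ∪ Qbc ∪ Qbd ∪ Qcd) E₂ → Qac ∪ Qad ∪ Qbc ∪ Qbd ∪ Qcd ∪ E₂ ⊆ N₀ →
      (∀ z : V, (∃ e ∈ Qac ∪ Qad ∪ Qbc ∪ Qbd ∪ Qcd, z ∈ e) → (∃ e ∈ E₂, z ∈ e) → z = x ∨ z = y) →
      E ⊆ Qac ∪ Qad ∪ Qbc ∪ Qbd ∪ Qcd ∪ E₂ → C ⊆ Qac ∪ Qad ∪ Qbc ∪ Qbd ∪ Qcd ∪ E₂ →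
      (∃ e ∈ Qac, s ∈ e) → s ≠ x → s ≠ c →
      (∃ e ∈ Qcd, t ∈ e) → t ≠ c → t ≠ d → (∃ e ∈ E₂, b ∈ e) → b ≠ x → b ≠ y → SPGoodC E C b s t)
    (hVee : ∀ {Qac Qad Qbc Qbd Qcd E₂ E C : Finset (Sym2 V)} {x y c d b t : V},
      IsKNet Qac x c → IsKNet Qad x d → IsKNet Qbc y c → IsKNet Qbd y d → IsKNet Qcd c d → BridgeSep Qac Qad Qbc Qbd Qcd x y c d →
      IsKNet E₂ x y → Disjoint (Qac ∪ Qad ∪ Qbc ∪ Qbd ∪ Qcd) E₂ → Qac ∪ Qad ∪ Qbc ∪ Qbd ∪ Qcd ∪ E₂ ⊆ N₀ →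
      (∀ z : V, (∃ e ∈ Qac ∪ Qad ∪ Qbc ∪ Qbd ∪ Qcd, z ∈ e) → (∃ e ∈ E₂, z ∈ e) → z = x ∨ z = y) →
      E ⊆ Qac ∪ Qad ∪ Qbc ∪ Qbd ∪ Qcd ∪ E₂ → C ⊆ Qac ∪ Qad ∪ Qbc ∪ Qbd ∪ Qcd ∪ E₂ →
      (∃ e ∈ Qad, t ∈ e) → t ≠ x → t ≠ d → (∃ e ∈ E₂, b ∈ e) → b ≠ x → b ≠ y → SPGoodC E C b c t)
    (hac : IsKNet Qac x c) (had : IsKNet Qad x d) (hbc : IsKNet Qbc y c) (hbd : IsKNet Qbd y d) (hcd : IsKNet Qcd c d)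
    (hsep : BridgeSep Qac Qad Qbc Qbd Qcd x y c d) (hcard : (Qac ∪ Qad ∪ Qbc ∪ Qbd ∪ Qcd).card ≤ n + 1) (h₂ : IsKNet E₂ x y)
    (hd : Disjoint (Qac ∪ Qad ∪ Qbc ∪ Qbd ∪ Qcd) E₂) (hN : Qac ∪ Qad ∪ Qbc ∪ Qbd ∪ Qcd ∪ E₂ ⊆ N₀)
    (hV : ∀ z : V, (∃ e ∈ Qac ∪ Qad ∪ Qbc ∪ Qbd ∪ Qcd, z ∈ e) → (∃ e ∈ E₂, z ∈ e) → z = x ∨ z = y)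
    (hE : E ⊆ Qac ∪ Qad ∪ Qbc ∪ Qbd ∪ Qcd ∪ E₂) (hC : C ⊆ Qac ∪ Qad ∪ Qbc ∪ Qbd ∪ Qcd ∪ E₂)
    (hb : ∃ e ∈ E₂, b ∈ e) (hbx : b ≠ x) (hby : b ≠ y)
    (hs : ∃ e ∈ Qac, s ∈ e) (hsx : s ≠ x) (hsc : s ≠ c)
    (ht : ∃ e ∈ Qac ∪ Qad ∪ Qbc ∪ Qbd ∪ Qcd, t ∈ e) (htx : t ≠ x) (hty : t ≠ y) (hst : s ≠ t) : SPGoodC E C b s t := by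
  by_cases htc : t = c
  · subst htc
    exact (typeIK_bridge_corner_ac hac had hbc hbd hcd hsep h₂ hd hV hE hC hs hb hsx hsc hbx hby).swap23
  by_cases htd : t = d
  · subst htd
    have eN : Qac ∪ Qad ∪ Qbc ∪ Qbd ∪ Qcd = Qad ∪ Qac ∪ Qbd ∪ Qbc ∪ Qcd := by ac_rfl
    rw [eN] at hd hN hV hE hC
    exact (hVee had hac hbd hbc hcd.symm hsep.swap_cd h₂ hd hN hV hE hC hs hsx hsc hb hbx hby).swap23
  obtain ⟨e, he, hte⟩ := ht
  simp only [Finset.mem_union] at he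
  rcases he with (((he | he) | he) | he) | he
  · exact typeIK_bridge_slot_ac ih hac had hbc hbd hcd hsep hcard h₂ hd hN hV hE hC hs ⟨e, he, hte⟩ hb hsx hsc htx htc hbx hby hst
  · exact hClaw hac had hbc hbd hcd hsep h₂ hd hN hV hE hC hs hsx hsc ⟨e, he, hte⟩ htx htd hb hbx hby
  · exact hTri hac had hbc hbd hcd hsep h₂ hd hN hV hE hC hs hsx hsc ⟨e, he, hte⟩ hty htc hb hbx hby
  · exact hPathMid hac had hbc hbd hcd hsep h₂ hd hN hV hE hC hs hsx hsc ⟨e, he, hte⟩ hty htd hb hbx hby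
  · exact hPathEnd hac had hbc hbd hcd hsep h₂ hd hN hV hE hC hs hsx hsc ⟨e, he, hte⟩ htc htd hb hbx hby

/-- Type I, bridge side, the mark `s` interior to the slot `cd` (dispatch on `t`). [cite: AyyerLinussonRavichandran2025, §7 (p. 22)] -/
theorem typeIK_bridge_in_cd
    (ih : ∀ {E₁ E₂ E C : Finset (Sym2 V)} {x y b s t : V}, E₁.card ≤ n →
      IsKNet E₁ x y → IsKNet E₂ x y → Disjoint E₁ E₂ → E₁ ∪ E₂ ⊆ N₀ →
      (∀ z : V, (∃ e ∈ E₁, z ∈ e) → (∃ e ∈ E₂, z ∈ e) → z = x ∨ z = y) →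
      E ⊆ E₁ ∪ E₂ → C ⊆ E₁ ∪ E₂ →
      (∃ e ∈ E₁, s ∈ e) → (∃ e ∈ E₁, t ∈ e) → (∃ e ∈ E₂, b ∈ e) →
      s ≠ x → s ≠ y → t ≠ x → t ≠ y → b ≠ x → b ≠ y → s ≠ t → SPGoodC E C b s t)
    (hPathEnd : ∀ {Qac Qad Qbc Qbd Qcd E₂ E C : Finset (Sym2 V)} {x y c d b s t : V},
      IsKNet Qac x c → IsKNet Qad x d → IsKNet Qbc y c → IsKNet Qbd y d → IsKNet Qcd c d → BridgeSep Qac Qad Qbc Qbd Qcd x y c d →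
      IsKNet E₂ x y → Disjoint (Qac ∪ Qad ∪ Qbc ∪ Qbd ∪ Qcd) E₂ → Qac ∪ Qad ∪ Qbc ∪ Qbd ∪ Qcd ∪ E₂ ⊆ N₀ →
      (∀ z : V, (∃ e ∈ Qac ∪ Qad ∪ Qbc ∪ Qbd ∪ Qcd, z ∈ e) → (∃ e ∈ E₂, z ∈ e) → z = x ∨ z = y) →
      E ⊆ Qac ∪ Qad ∪ Qbc ∪ Qbd ∪ Qcd ∪ E₂ → C ⊆ Qac ∪ Qad ∪ Qbc ∪ Qbd ∪ Qcd ∪ E₂ →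
      (∃ e ∈ Qac, s ∈ e) → s ≠ x → s ≠ c →
      (∃ e ∈ Qcd, t ∈ e) → t ≠ c → t ≠ d → (∃ e ∈ E₂, b ∈ e) → b ≠ x → b ≠ y → SPGoodC E C b s t)
    (hac : IsKNet Qac x c) (had : IsKNet Qad x d) (hbc : IsKNet Qbc y c) (hbd : IsKNet Qbd y d) (hcd : IsKNet Qcd c d)
    (hsep : BridgeSep Qac Qad Qbc Qbd Qcd x y c d) (hcard : (Qac ∪ Qad ∪ Qbc ∪ Qbd ∪ Qcd).card ≤ n + 1) (h₂ : IsKNet E₂ x y)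
    (hd : Disjoint (Qac ∪ Qad ∪ Qbc ∪ Qbd ∪ Qcd) E₂) (hN : Qac ∪ Qad ∪ Qbc ∪ Qbd ∪ Qcd ∪ E₂ ⊆ N₀)
    (hV : ∀ z : V, (∃ e ∈ Qac ∪ Qad ∪ Qbc ∪ Qbd ∪ Qcd, z ∈ e) → (∃ e ∈ E₂, z ∈ e) → z = x ∨ z = y)
    (hE : E ⊆ Qac ∪ Qad ∪ Qbc ∪ Qbd ∪ Qcd ∪ E₂) (hC : C ⊆ Qac ∪ Qad ∪ Qbc ∪ Qbd ∪ Qcd ∪ E₂)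
    (hb : ∃ e ∈ E₂, b ∈ e) (hbx : b ≠ x) (hby : b ≠ y)
    (hs : ∃ e ∈ Qcd, s ∈ e) (hsc : s ≠ c) (hsd : s ≠ d)
    (ht : ∃ e ∈ Qac ∪ Qad ∪ Qbc ∪ Qbd ∪ Qcd, t ∈ e) (htx : t ≠ x) (hty : t ≠ y) (hst : s ≠ t) : SPGoodC E C b s t := by
  by_cases htc : t = c
  · subst htc
    exact (typeIK_bridge_corner_cd hac had hbc hbd hcd hsep h₂ hd hV hE hC hs hb hsc hsd hbx hby).swap23
  by_cases htd : t = d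
  · subst htd
    have eN : Qac ∪ Qad ∪ Qbc ∪ Qbd ∪ Qcd = Qad ∪ Qac ∪ Qbd ∪ Qbc ∪ Qcd := by ac_rfl
    rw [eN] at hd hN hV hE hC
    exact (typeIK_bridge_corner_cd had hac hbd hbc hcd.symm hsep.swap_cd h₂ hd hV hE hC hs hb hsd hsc hbx hby).swap23
  obtain ⟨e, he, hte⟩ := ht
  simp only [Finset.mem_union] at he
  rcases he with (((he | he) | he) | he) | he
  · exact (hPathEnd hac had hbc hbd hcd hsep h₂ hd hN hV hE hC ⟨e, he, hte⟩ htx htc hs hsc hsd hb hbx hby).swap23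
  · have eN : Qac ∪ Qad ∪ Qbc ∪ Qbd ∪ Qcd = Qad ∪ Qac ∪ Qbd ∪ Qbc ∪ Qcd := by ac_rfl
    rw [eN] at hd hN hV hE hC
    exact (hPathEnd had hac hbd hbc hcd.symm hsep.swap_cd h₂ hd hN hV hE hC ⟨e, he, hte⟩ htx htd hs hsd hsc hb hbx hby).swap23
  · have eN : Qac ∪ Qad ∪ Qbc ∪ Qbd ∪ Qcd = Qbc ∪ Qbd ∪ Qac ∪ Qad ∪ Qcd := by ac_rfl
    rw [eN] at hd hN hV hE hC
    exact (hPathEnd hbc hbd hac had hcd hsep.symm h₂.symm hd hN (fun z h1 h2 => (hV z h1 h2).symm) hE hC ⟨e, he, hte⟩ hty htc hs hsc hsd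
      hb hby hbx).swap23
  · have eN : Qac ∪ Qad ∪ Qbc ∪ Qbd ∪ Qcd = Qbd ∪ Qbc ∪ Qad ∪ Qac ∪ Qcd := by ac_rfl
    rw [eN] at hd hN hV hE hC
    exact (hPathEnd hbd hbc had hac hcd.symm hsep.symm.swap_cd h₂.symm hd hN (fun z h1 h2 => (hV z h1 h2).symm) hE hC ⟨e, he, hte⟩ hty
      htd hs hsd hsc hb hby hbx).swap23
  · exact typeIK_bridge_slot_cd ih hac had hbc hbd hcd hsep hcard h₂ hd hN hV hE hC hs ⟨e, he, hte⟩ hb hsc hsd htc htd hbx hby hst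

/-- **THE TYPE-I BRIDGE BRANCH, modulo the five K-state leaves**: the `| bridge` alternative of `FK.typeIK_good` (census g41 drafts)
follows from the induction hypothesis and the leaf hypotheses by locating the two `E₁`-marks (corner / slot) and reducing every position to
the canonical ones by `FK.BridgeSep.swap_cd / symm`. [cite: AyyerLinussonRavichandran2025, §7 (p. 22)] -/
theorem typeIK_bridge_dispatch
    (ih : ∀ {E₁ E₂ E C : Finset (Sym2 V)} {x y b s t : V}, E₁.card ≤ n →
      IsKNet E₁ x y → IsKNet E₂ x y → Disjoint E₁ E₂ → E₁ ∪ E₂ ⊆ N₀ →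
      (∀ z : V, (∃ e ∈ E₁, z ∈ e) → (∃ e ∈ E₂, z ∈ e) → z = x ∨ z = y) →
      E ⊆ E₁ ∪ E₂ → C ⊆ E₁ ∪ E₂ →
      (∃ e ∈ E₁, s ∈ e) → (∃ e ∈ E₁, t ∈ e) → (∃ e ∈ E₂, b ∈ e) →
      s ≠ x → s ≠ y → t ≠ x → t ≠ y → b ≠ x → b ≠ y → s ≠ t → SPGoodC E C b s t)
    (hTri : ∀ {Qac Qad Qbc Qbd Qcd E₂ E C : Finset (Sym2 V)} {x y c d b s t : V},
      IsKNet Qac x c → IsKNet Qad x d → IsKNet Qbc y c → IsKNet Qbd y d → IsKNet Qcd c d → BridgeSep Qac Qad Qbc Qbd Qcd x y c d →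
      IsKNet E₂ x y → Disjoint (Qac ∪ Qad ∪ Qbc ∪ Qbd ∪ Qcd) E₂ → Qac ∪ Qad ∪ Qbc ∪ Qbd ∪ Qcd ∪ E₂ ⊆ N₀ →
      (∀ z : V, (∃ e ∈ Qac ∪ Qad ∪ Qbc ∪ Qbd ∪ Qcd, z ∈ e) → (∃ e ∈ E₂, z ∈ e) → z = x ∨ z = y) →
      E ⊆ Qac ∪ Qad ∪ Qbc ∪ Qbd ∪ Qcd ∪ E₂ → C ⊆ Qac ∪ Qad ∪ Qbc ∪ Qbd ∪ Qcd ∪ E₂ →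
      (∃ e ∈ Qac, s ∈ e) → s ≠ x → s ≠ c →
      (∃ e ∈ Qbc, t ∈ e) → t ≠ y → t ≠ c → (∃ e ∈ E₂, b ∈ e) → b ≠ x → b ≠ y → SPGoodC E C b s t)
    (hClaw : ∀ {Qac Qad Qbc Qbd Qcd E₂ E C : Finset (Sym2 V)} {x y c d b s t : V},
      IsKNet Qac x c → IsKNet Qad x d → IsKNet Qbc y c → IsKNet Qbd y d → IsKNet Qcd c d → BridgeSep Qac Qad Qbc Qbd Qcd x y c d →
      IsKNet E₂ x y → Disjoint (Qac ∪ Qad ∪ Qbc ∪ Qbd ∪ Qcd) E₂ → Qac ∪ Qad ∪ Qbc ∪ Qbd ∪ Qcd ∪ E₂ ⊆ N₀ →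
      (∀ z : V, (∃ e ∈ Qac ∪ Qad ∪ Qbc ∪ Qbd ∪ Qcd, z ∈ e) → (∃ e ∈ E₂, z ∈ e) → z = x ∨ z = y) →
      E ⊆ Qac ∪ Qad ∪ Qbc ∪ Qbd ∪ Qcd ∪ E₂ → C ⊆ Qac ∪ Qad ∪ Qbc ∪ Qbd ∪ Qcd ∪ E₂ →
      (∃ e ∈ Qac, s ∈ e) → s ≠ x → s ≠ c →
      (∃ e ∈ Qad, t ∈ e) → t ≠ x → t ≠ d → (∃ e ∈ E₂, b ∈ e) → b ≠ x → b ≠ y → SPGoodC E C b s t)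
    (hPathMid : ∀ {Qac Qad Qbc Qbd Qcd E₂ E C : Finset (Sym2 V)} {x y c d b s t : V},
      IsKNet Qac x c → IsKNet Qad x d → IsKNet Qbc y c → IsKNet Qbd y d → IsKNet Qcd c d → BridgeSep Qac Qad Qbc Qbd Qcd x y c d →
      IsKNet E₂ x y → Disjoint (Qac ∪ Qad ∪ Qbc ∪ Qbd ∪ Qcd) E₂ → Qac ∪ Qad ∪ Qbc ∪ Qbd ∪ Qcd ∪ E₂ ⊆ N₀ →
      (∀ z : V, (∃ e ∈ Qac ∪ Qad ∪ Qbc ∪ Qbd ∪ Qcd, z ∈ e) → (∃ e ∈ E₂, z ∈ e) → z = x ∨ z = y) →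
      E ⊆ Qac ∪ Qad ∪ Qbc ∪ Qbd ∪ Qcd ∪ E₂ → C ⊆ Qac ∪ Qad ∪ Qbc ∪ Qbd ∪ Qcd ∪ E₂ →
      (∃ e ∈ Qac, s ∈ e) → s ≠ x → s ≠ c →
      (∃ e ∈ Qbd, t ∈ e) → t ≠ y → t ≠ d → (∃ e ∈ E₂, b ∈ e) → b ≠ x → b ≠ y → SPGoodC E C b s t)
    (hPathEnd : ∀ {Qac Qad Qbc Qbd Qcd E₂ E C : Finset (Sym2 V)} {x y c d b s t : V},
      IsKNet Qac x c → IsKNet Qad x d → IsKNet Qbc y c → IsKNet Qbd y d → IsKNet Qcd c d → BridgeSep Qac Qad Qbc Qbd Qcd x y c d →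
      IsKNet E₂ x y → Disjoint (Qac ∪ Qad ∪ Qbc ∪ Qbd ∪ Qcd) E₂ → Qac ∪ Qad ∪ Qbc ∪ Qbd ∪ Qcd ∪ E₂ ⊆ N₀ →
      (∀ z : V, (∃ e ∈ Qac ∪ Qad ∪ Qbc ∪ Qbd ∪ Qcd, z ∈ e) → (∃ e ∈ E₂, z ∈ e) → z = x ∨ z = y) →
      E ⊆ Qac ∪ Qad ∪ Qbc ∪ Qbd ∪ Qcd ∪ E₂ → C ⊆ Qac ∪ Qad ∪ Qbc ∪ Qbd ∪ Qcd ∪ E₂ →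
      (∃ e ∈ Qac, s ∈ e) → s ≠ x → s ≠ c →
      (∃ e ∈ Qcd, t ∈ e) → t ≠ c → t ≠ d → (∃ e ∈ E₂, b ∈ e) → b ≠ x → b ≠ y → SPGoodC E C b s t)
    (hVee : ∀ {Qac Qad Qbc Qbd Qcd E₂ E C : Finset (Sym2 V)} {x y c d b t : V},
      IsKNet Qac x c → IsKNet Qad x d → IsKNet Qbc y c → IsKNet Qbd y d → IsKNet Qcd c d → BridgeSep Qac Qad Qbc Qbd Qcd x y c d →
      IsKNet E₂ x y → Disjoint (Qac ∪ Qad ∪ Qbc ∪ Qbd ∪ Qcd) E₂ → Qac ∪ Qad ∪ Qbc ∪ Qbd ∪ Qcd ∪ E₂ ⊆ N₀ →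
      (∀ z : V, (∃ e ∈ Qac ∪ Qad ∪ Qbc ∪ Qbd ∪ Qcd, z ∈ e) → (∃ e ∈ E₂, z ∈ e) → z = x ∨ z = y) →
      E ⊆ Qac ∪ Qad ∪ Qbc ∪ Qbd ∪ Qcd ∪ E₂ → C ⊆ Qac ∪ Qad ∪ Qbc ∪ Qbd ∪ Qcd ∪ E₂ →
      (∃ e ∈ Qad, t ∈ e) → t ≠ x → t ≠ d → (∃ e ∈ E₂, b ∈ e) → b ≠ x → b ≠ y → SPGoodC E C b c t)
    (hac : IsKNet Qac x c) (had : IsKNet Qad x d) (hbc : IsKNet Qbc y c) (hbd : IsKNet Qbd y d) (hcd : IsKNet Qcd c d)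
    (hsep : BridgeSep Qac Qad Qbc Qbd Qcd x y c d) (hcard : (Qac ∪ Qad ∪ Qbc ∪ Qbd ∪ Qcd).card ≤ n + 1) (h₂ : IsKNet E₂ x y)
    (hd : Disjoint (Qac ∪ Qad ∪ Qbc ∪ Qbd ∪ Qcd) E₂) (hN : Qac ∪ Qad ∪ Qbc ∪ Qbd ∪ Qcd ∪ E₂ ⊆ N₀)
    (hV : ∀ z : V, (∃ e ∈ Qac ∪ Qad ∪ Qbc ∪ Qbd ∪ Qcd, z ∈ e) → (∃ e ∈ E₂, z ∈ e) → z = x ∨ z = y)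
    (hE : E ⊆ Qac ∪ Qad ∪ Qbc ∪ Qbd ∪ Qcd ∪ E₂) (hC : C ⊆ Qac ∪ Qad ∪ Qbc ∪ Qbd ∪ Qcd ∪ E₂)
    (hb : ∃ e ∈ E₂, b ∈ e) (hbx : b ≠ x) (hby : b ≠ y)
    (hs : ∃ e ∈ Qac ∪ Qad ∪ Qbc ∪ Qbd ∪ Qcd, s ∈ e) (ht : ∃ e ∈ Qac ∪ Qad ∪ Qbc ∪ Qbd ∪ Qcd, t ∈ e)
    (hsx : s ≠ x) (hsy : s ≠ y) (htx : t ≠ x) (hty : t ≠ y) (hst : s ≠ t) : SPGoodC E C b s t := by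
  by_cases hsc : s = c
  · subst hsc
    exact typeIK_bridge_at_c hVee hac had hbc hbd hcd hsep h₂ hd hN hV hE hC hb hbx hby ht htx hty (Ne.symm hst)
  by_cases hsd : s = d
  · subst hsd
    have eN : Qac ∪ Qad ∪ Qbc ∪ Qbd ∪ Qcd = Qad ∪ Qac ∪ Qbd ∪ Qbc ∪ Qcd := by ac_rfl
    rw [eN] at hcard hd hN hV hE hC ht
    exact typeIK_bridge_at_c hVee had hac hbd hbc hcd.symm hsep.swap_cd h₂ hd hN hV hE hC hb hbx hby ht htx hty (Ne.symm hst)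
  obtain ⟨e, he, hse⟩ := hs
  simp only [Finset.mem_union] at he
  rcases he with (((he | he) | he) | he) | he
  · exact typeIK_bridge_in_ac ih hTri hClaw hPathMid hPathEnd hVee hac had hbc hbd hcd hsep hcard h₂ hd hN hV hE hC hb hbx hby
      ⟨e, he, hse⟩ hsx hsc ht htx hty hst
  · have eN : Qac ∪ Qad ∪ Qbc ∪ Qbd ∪ Qcd = Qad ∪ Qac ∪ Qbd ∪ Qbc ∪ Qcd := by ac_rfl
    rw [eN] at hcard hd hN hV hE hC ht
    exact typeIK_bridge_in_ac ih hTri hClaw hPathMid hPathEnd hVee had hac hbd hbc hcd.symm hsep.swap_cd hcard h₂ hd hN hV hE hC hb hbx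
      hby ⟨e, he, hse⟩ hsx hsd ht htx hty hst
  · have eN : Qac ∪ Qad ∪ Qbc ∪ Qbd ∪ Qcd = Qbc ∪ Qbd ∪ Qac ∪ Qad ∪ Qcd := by ac_rfl
    rw [eN] at hcard hd hN hV hE hC ht
    exact typeIK_bridge_in_ac ih hTri hClaw hPathMid hPathEnd hVee hbc hbd hac had hcd hsep.symm hcard h₂.symm hd hN
      (fun z h1 h2 => (hV z h1 h2).symm) hE hC hb hby hbx ⟨e, he, hse⟩ hsy hsc ht hty htx hst
  · have eN : Qac ∪ Qad ∪ Qbc ∪ Qbd ∪ Qcd = Qbd ∪ Qbc ∪ Qad ∪ Qac ∪ Qcd := by ac_rfl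
    rw [eN] at hcard hd hN hV hE hC ht
    exact typeIK_bridge_in_ac ih hTri hClaw hPathMid hPathEnd hVee hbd hbc had hac hcd.symm hsep.symm.swap_cd hcard h₂.symm hd hN
      (fun z h1 h2 => (hV z h1 h2).symm) hE hC hb hby hbx ⟨e, he, hse⟩ hsy hsd ht hty htx hst
  · exact typeIK_bridge_in_cd ih hPathEnd hac had hbc hbd hcd hsep hcard h₂ hd hN hV hE hC hb hbx hby ⟨e, he, hse⟩ hsc hsd ht htx hty hst


end TypeIBridge

end FK

end Summit.CriticalPhenomena.PercolationContinuityZ3.Theorems
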